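import Summits.AtomisticToContinuum.BoseEinsteinCondensation.Theorems.BECThomsonPrincipleGDTransferSeededPlainDirections
import Summits.AtomisticToContinuum.BoseEinsteinCondensation.Theorems.BECThomsonPrincipleGDTransferSeededPlainZeroDefect
import Summits.AtomisticToContinuum.BoseEinsteinCondensation.Theorems.BECThomsonPrincipleGDTransferSeededPlainKinetic

/-!
# Route `BECThomsonPrinciple`, crux `GDTransfer` (stmt-AtomisticToContinuum-9482), line `seeded-continuity`:
# stub `stub_plainPairAlgebra` — assembly

The registered stub `stub_plainPairAlgebra : LNSSAlgebra → PlainPairAlgebra ∧ PlainKineticIdentity` of skeleton v3,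
assembled from its three landed parts: (A1)+(A2) `plainPair_apriori` (`…SeededPlainDirections`), (A3)+(A4)
`plainPair_zeroDefect` (`…SeededPlainZeroDefect`) and the exact kinetic identity `plainKineticIdentity`
(`…SeededPlainKinetic`).  The hypothesis `LNSSAlgebra` of the registered signature is not needed (the parts were proved
outright), so it is discarded.  All [folklore] (KennedyLiebShastry1988; arXiv:1211.2778 §2; LSSY2005 App. A).
-/

noncomputable section

namespace Summit.AtomisticToContinuum.BoseEinsteinCondensation.Cruxes.GDTransfer.Seeded

/-- **`PlainPairAlgebra` holds** (unconditionally): (A1)–(A4) of the plain pair `ζ₊ = N^{-1/2}B_nΨ`, `ζ₋ = N^{-1/2}B_n†Ψ`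
for finite continuous repulsive profiles. [folklore] -/
theorem plainPairAlgebra : PlainPairAlgebra := by
  intro v hv hfc m L hL
  obtain ⟨R₀, hR₀, h⟩ := plainPair_apriori v hv hfc m L hL
  refine ⟨R₀, hR₀, fun n Ψ => ?_⟩
  obtain ⟨h1, h2, h3, h4, h5, h6⟩ := h n Ψ
  obtain ⟨h7, h8⟩ := plainPair_zeroDefect m L hL n Ψ
  exact ⟨h1, h2, h3, h4, h5, h6, h7, h8⟩

/-- **The registered stub `stub_plainPairAlgebra` of skeleton v3** (`LNSSAlgebra → PlainPairAlgebra ∧ PlainKineticIdentity`):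
directions, budgets, zero defect, weighted occupation and the exact kinetic identity of the plain pair. [folklore] -/
theorem stub_plainPairAlgebra : Sig.stub_plainPairAlgebra :=
  fun _ => ⟨plainPairAlgebra, plainKineticIdentity⟩

end Summit.AtomisticToContinuum.BoseEinsteinCondensation.Cruxes.GDTransfer.Seeded

end
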